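import Literature.MathematicalPhysics.QuantumFieldTheory.Balaban1983to89.T3LimitLawAtomless
import HarnessLib

/-!
# `Balaban1983to89.T3LimitLawNoLinearRelation` — under K1 ∧ K2 the continuum loop law of `SU(2)` YM₃ on a three-torus charges NO HYPERPLANE of the
# coordinates of simple loops with private bonds: every non-trivial linear combination `Σ aᵢ x_{Cᵢ}` has an atomless law (JOINT non-degeneracy)

Cell `ym3-torus` (HUMAN RULING D-0037, YM ladder rung R3), seat `ym3-torus-p2` gen 15 (HOME/IR-NODE.md §21; companion of `T3LimitLawAtomless`).  WHAT THIS
IS NOT: not d = 4, not infinite volume, not a mass gap, not Clay; `UnitTiltTail` (K1 ∧ K2, the route's three load-bearing cruxes) is an OPEN hypothesis;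
`SU(2)` and the printed averaging.

THE OBSERVATION.  Given finitely many step lists `γⱼ` (`j ∈ Fin k`) and one index `i` whose list visits a bond `b` exactly once while NO other
list visits `b` («private once-visited bond»), the linear combination `u ↦ Σⱼ aⱼ · reTr 𝒰(γⱼ)(u)` is ONE-LINK QUATERNION-AFFINE through `b` with datum
`aᵢ • q`, `‖q‖ = 1` (`T3NontrivialityFromTiltLabels.linkAffine_reTr_holAt_split` for `j = i`, independence of `U(b)` for `j ≠ i`, `T4WilsonLinkAffine`'s
closure under sums and scalars).  So for `aᵢ ≠ 0` its level sets are product-Haar-null (§1), the refined unit laws give it no atom (§2), and King's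
event device with the tent portmanteau (`T3LimitLawAtomless`) transfers this to the weak limit: **`ν{y | Σⱼ aⱼ y_{Cⱼ} = t} = 0`** (§3).  In
particular no deterministic linear relation holds among such continuum loop variables, and their covariance matrix under `ν` is non-singular
(every `aᵀΣa = Var_ν(Σ aⱼ x_{Cⱼ})` is positive since an atomless bounded law is not a point mass) — recorded in the docstrings, the typed statement
is the hyperplane nullity.

References: C. King, CMP 102 (1986) [King1986] (Thm 3.4 (3.13) p.657); S. Chatterjee [Chatterjee2019YMProbabilists] (§2, §6 p.19), [Chatterjee2026YMHiggs] (§3.2);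
A. Jaffe, E. Witten [JaffeWittenClay2006] (§6.5 p.11); T. Bałaban [Balaban1987RG1] ((0.11) p.253).
-/

noncomputable section

open MeasureTheory Filter Topology ProbabilityTheory Set BoundedContinuousFunction
open scoped NNReal ENNReal Quaternion BigOperators
open Literature.MathematicalPhysics.QuantumFieldTheory.Balaban1983to89
open Literature.MathematicalPhysics.QuantumFieldTheory.Balaban1983to89.Missing
open Literature.MathematicalPhysics.QuantumFieldTheory.Balaban1983to89.T4Continuum
open Literature.MathematicalPhysics.QuantumFieldTheory.Balaban1983to89.T4LimitLaw
open Literature.MathematicalPhysics.QuantumFieldTheory.Balaban1983to89.T3ContinuumYM3Torus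
open Literature.MathematicalPhysics.QuantumFieldTheory.Balaban1983to89.T3ThresholdRemoval
open Literature.MathematicalPhysics.QuantumFieldTheory.Balaban1983to89.T3LevelShift
open Literature.MathematicalPhysics.QuantumFieldTheory.Balaban1983to89.T3UnitScaleTilt
open Literature.MathematicalPhysics.QuantumFieldTheory.Balaban1983to89.T3TailTransfer
open Literature.MathematicalPhysics.QuantumFieldTheory.Balaban1983to89.T3UnitLawDensityEML (ℰp measurableE_ℰp)
open Literature.MathematicalPhysics.QuantumFieldTheory.Balaban1983to89.T3NontrivialityFromTilt
open Literature.MathematicalPhysics.QuantumFieldTheory.Balaban1983to89.T3NontrivialityFromTiltRefine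
open Literature.MathematicalPhysics.QuantumFieldTheory.Balaban1983to89.T3NontrivialityFromTiltLabels
open Literature.MathematicalPhysics.QuantumFieldTheory.Balaban1983to89.T3LimitLawAtomless
open Literature.MathematicalPhysics.QuantumFieldTheory.Balaban1983to89.T4CubeChartGnomonic (SU2)
open Literature.MathematicalPhysics.QuantumFieldTheory.Balaban1983to89.T4GnomonicWilsonHessian (LinkAffine)
open Literature.MathematicalPhysics.QuantumFieldTheory.Balaban1983to89.T4WilsonLinkAffine (linkAffine_smul linkAffine_sum)

namespace Literature.MathematicalPhysics.QuantumFieldTheory.Balaban1983to89.T3LimitLawNoLinearRelation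

/-! ## §1 A private once-visited bond makes a linear combination of loop variables one-link affine with non-zero datum -/

section Product

variable {P : Params} {j : ℕ} {k : ℕ}

/-- **LINEAR COMBINATIONS THROUGH A PRIVATE ONCE-VISITED BOND ARE ONE-LINK AFFINE WITH NON-ZERO DATUM**: step lists `γ l` (`l : Fin k`), the
`i`-th of the form `γ₁ ++ s :: γ₂` with `s.bond ∉ γ₁, γ₂` and `s.bond ∉ γ l` for `l ≠ i`, coefficients `a` with `a i ≠ 0`: at every base field
`u ↦ Σ_l a l · reTr 𝒰(γ l)(u)` is `LinkAffine` through `s.bond` with a NON-ZERO datum. [cite: Chatterjee2019YMProbabilists, §2] -/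
theorem exists_linkAffine_linComb [DecidableEq (PBond P j)] (u : GaugeField P j SU2) (γ : Fin k → List (LStep P j)) (a : Fin k → ℝ)
    (i : Fin k) (γ₁ γ₂ : List (LStep P j)) (s : LStep P j) (hγi : γ i = γ₁ ++ s :: γ₂)
    (h₁ : ∀ s' ∈ γ₁, s'.bond ≠ s.bond) (h₂ : ∀ s' ∈ γ₂, s'.bond ≠ s.bond)
    (hpriv : ∀ l, l ≠ i → ∀ s' ∈ γ l, s'.bond ≠ s.bond) (hai : a i ≠ 0) :
    ∃ (κ : ℝ) (d : ℍ), d ≠ 0 ∧ LinkAffine (fun U => ∑ l, a l * GaugeGroup.reTr (holAt U (γ l))) u s.bond κ d := by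
  obtain ⟨q, hq1, hqi⟩ := linkAffine_reTr_holAt_split u γ₁ γ₂ s h₁ h₂
  have hq0 : q ≠ 0 := fun h0 => by rw [h0, norm_zero] at hq1; exact zero_ne_one hq1
  -- each summand is link-affine through `s.bond`: datum `a i • q` for `l = i`, `0` otherwise
  have hterm : ∀ l ∈ (Finset.univ : Finset (Fin k)),
      LinkAffine (fun U => a l * GaugeGroup.reTr (holAt U (γ l))) u s.bond
        (a l * (if l = i then 0 else GaugeGroup.reTr (holAt u (γ l)))) (if l = i then a l • q else 0) := by
    intro l _
    by_cases hl : l = i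
    · subst hl
      simp only [if_true]
      have := linkAffine_smul hqi (a l)
      rw [hγi]
      simpa using this
    · simp only [hl, if_false]
      intro g
      dsimp only
      rw [holAt_update_of_forall_ne u s.bond g (γ l) (hpriv l hl), mul_zero, Quaternion.re_zero, add_zero]
  refine ⟨_, _, ?_, linkAffine_sum Finset.univ hterm⟩
  rw [Finset.sum_ite_eq' Finset.univ i, if_pos (Finset.mem_univ i)]
  exact smul_ne_zero hai hq0

/-- Hence **THE LEVEL SETS OF SUCH A LINEAR COMBINATION ARE PRODUCT-HAAR-NULL**. [cite: Chatterjee2026YMHiggs, §3.2 (product Haar measure; Haar on SU(2) = uniform measure on S³)] -/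
theorem fieldMeasure_linCombLevel_eq_zero (γ : Fin k → List (LStep P j)) (a : Fin k → ℝ) (i : Fin k) (γ₁ γ₂ : List (LStep P j))
    (s : LStep P j) (hγi : γ i = γ₁ ++ s :: γ₂) (h₁ : ∀ s' ∈ γ₁, s'.bond ≠ s.bond) (h₂ : ∀ s' ∈ γ₂, s'.bond ≠ s.bond)
    (hpriv : ∀ l, l ≠ i → ∀ s' ∈ γ l, s'.bond ≠ s.bond) (hai : a i ≠ 0) (t : ℝ) :
    fieldMeasure P j SU2 {u | ∑ l, a l * loopAt u (γ l) = t} = 0 := by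
  classical
  refine fieldMeasure_level_eq_zero_of_linkAffine
    (Finset.measurable_sum _ fun l _ => (measurable_loopAt (γ l)).const_mul (a l)) s.bond (fun u => ?_) t
  obtain ⟨κ, d, hd, hLA⟩ := exists_linkAffine_linComb u γ a i γ₁ γ₂ s hγi h₁ h₂ hpriv hai
  exact ⟨κ, d, hd, hLA⟩

end Product

/-! ## §2 No atoms for the linear combination of the original family's strings read on a refined unit field -/

section Refined

variable (F : T3Family) (n : ℕ) {k : ℕ}

/-- GENERIC TRANSFER: a product-Haar-null set of the unit torus `T₁` pulls back, along `fieldShift` and the unit reading `unitShift ∘ avg^n` of the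
`n`-th approximation, to a NULL set of every unit law of the refined family (`SU(2)`, printed averaging, `γ' ≥ 0`). [cite: Balaban1985UV3, (2) p.256 + (6) p.257] -/
theorem refine_unitLaw_preimage_eq_zero {γ' : ℝ} (hγ' : 0 ≤ γ') (K : ℕ)
    {N : Set (GaugeField (F.P 0) 0 SU2)} (hN : MeasurableSet N) (hN0 : fieldMeasure (F.P 0) 0 SU2 N = 0) :
    (F.refine n).unitLaw ℰp measurableE_ℰp γ' K
      (fieldShift (sitesPerDir_refine_unit F n) ⁻¹' ((fun U => unitShift F n
        (Averaging.iter (fun j => BlockAveraging.blockAvg (P := F.P n) (j := j) ℰp) n U)) ⁻¹' N)) = 0 := by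
  rw [T3UnitLawDensityEML.unitLaw_eq_withDensity_emlDensity (F.refine n) K hγ']
  refine withDensity_absolutelyContinuous _ _ ?_
  have hmeas : ∀ j, Measurable (BlockAveraging.blockAvg (P := F.P n) (j := j) ℰp).avg :=
    fun j => F.avgMeasurable_of_measurableE ℰp measurableE_ℰp n j
  have hΦ : Measurable fun U : GaugeField (F.P n) 0 SU2 => unitShift F n
      (Averaging.iter (fun j => BlockAveraging.blockAvg (P := F.P n) (j := j) ℰp) n U) :=
    (measurable_unitShift F n).comp (measurable_iter _ hmeas n)
  have key := (measurePreserving_fieldShift (G := SU2) (sitesPerDir_refine_unit F n)).measure_preimage ((hΦ hN).nullMeasurableSet)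
  refine key.trans ?_
  change fieldMeasure (F.P n) 0 SU2 _ = 0
  rw [← Measure.map_apply hΦ hN]
  exact map_unitShift_iter_absolutelyContinuous F n hN0

/-- **NO ATOM FOR `Σ aⱼ coarseObs [Cⱼ]` UNDER THE REFINED UNIT LAWS** when the `i`-th label has a private once-visited bond and `aᵢ ≠ 0`.
[cite: Balaban1985UV3, (2) p.256 + (6) p.257] -/
theorem refine_unitLaw_linCombLevel_eq_zero {γ' : ℝ} (hγ' : 0 ≤ γ') (K : ℕ) (C : Fin k → ULoop3 F) (a : Fin k → ℝ) (i : Fin k)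
    (γ₁ γ₂ : List (LStep (F.P 0) 0)) (s : LStep (F.P 0) 0) (hCi : (C i).1.atLevel 0 = γ₁ ++ s :: γ₂)
    (h₁ : ∀ s' ∈ γ₁, s'.bond ≠ s.bond) (h₂ : ∀ s' ∈ γ₂, s'.bond ≠ s.bond)
    (hpriv : ∀ l, l ≠ i → ∀ s' ∈ (C l).1.atLevel 0, s'.bond ≠ s.bond) (hai : a i ≠ 0) (t : ℝ) :
    (F.refine n).unitLaw ℰp measurableE_ℰp γ' K {u | ∑ l, a l * coarseObs F n ℰp [C l] u = t} = 0 := by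
  set N : Set (GaugeField (F.P 0) 0 SU2) := {v | ∑ l, a l * loopAt v ((C l).1.atLevel 0) = t} with hN_def
  have hN : MeasurableSet N :=
    (Finset.measurable_sum _ fun l _ => (measurable_loopAt ((C l).1.atLevel 0)).const_mul (a l)) (measurableSet_singleton t)
  have hN0 : fieldMeasure (F.P 0) 0 SU2 N = 0 :=
    fieldMeasure_linCombLevel_eq_zero (fun l => (C l).1.atLevel 0) a i γ₁ γ₂ s hCi h₁ h₂ hpriv hai t
  have hset : {u : GaugeField ((F.refine n).P 0) 0 SU2 | ∑ l, a l * coarseObs F n ℰp [C l] u = t} =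
      fieldShift (sitesPerDir_refine_unit F n) ⁻¹' ((fun U => unitShift F n
        (Averaging.iter (fun j => BlockAveraging.blockAvg (P := F.P n) (j := j) ℰp) n U)) ⁻¹' N) := by
    ext u
    simp only [mem_setOf_eq, hN_def, coarseObs_singleton, T3Family.avgObs_eq_loopAt_unitShift]
    rfl
  rw [hset]
  exact refine_unitLaw_preimage_eq_zero F n hγ' K hN hN0

end Refined

/-! ## §3 The limit law charges no hyperplane -/

section Limit

variable {r w w' : ℕ → ℝ} {k : ℕ}

/-- **MULTI-OBSERVABLE REFINEMENT IDENTITY**: for measurable `g : (Fin k → ℝ) → ℝ`, the Gibbs integral of `g((W̄_{Cⱼ})ⱼ)` at step `K + n` of `F` is the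
refined family's unit-law integral of `g((coarseObs F n ℰ [Cⱼ])ⱼ)` at step `K`. [cite: Balaban1987RG1, (0.11) p.253] -/
theorem integral_comp_avgObsVec_refine (F : T3Family) (n : ℕ) {G : Type*} [GaugeGroup G] [MeasurableSpace G] [HaarData G]
    [RegularGaugeGroup G] (ℰ : LoopAverage G) (hE : ℰ.MeasurableE) {γ : ℝ} (hγ : 0 ≤ γ) (K : ℕ) (C : Fin k → ULoop3 F)
    {g : (Fin k → ℝ) → ℝ} (hg : Measurable g) :
    ∫ U, g (fun l => F.avgObs ℰ (K + n) (C l) U) ∂T4GenFunBounds.gibbsMeasure (F.P (K + n)) ((F.scheme ℰ γ).β (K + n)) =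
      ∫ u, g (fun l => coarseObs F n ℰ [C l] u) ∂(F.refine n).unitLaw ℰ hE (γ * ((F.L : ℝ)⁻¹) ^ n) K := by
  have hβ : 0 ≤ (F.scheme ℰ γ).β (K + n) := F.scheme_β_nonneg ℰ hγ (K + n)
  have hcs : ∀ (l : Fin k) (u : GaugeField ((F.refine n).P 0) 0 G),
      coarseObs F n ℰ [C l] u = F.avgObs ℰ n (C l) (fieldShift (sitesPerDir_refine_unit F n) u) := fun l u => by
    simp [coarseObs]
  have hmeas : Measurable fun u : GaugeField ((F.refine n).P 0) 0 G => g (fun l => coarseObs F n ℰ [C l] u) :=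
    hg.comp (measurable_pi_lambda _ fun l => measurable_coarseObs F n ℰ hE [C l])
  calc ∫ U, g (fun l => F.avgObs ℰ (K + n) (C l) U) ∂T4GenFunBounds.gibbsMeasure (F.P (K + n)) ((F.scheme ℰ γ).β (K + n))
      = ∫ U, g (fun l => F.avgObs ℰ (K + n) (C l) U) ∂T4GenFunBounds.gibbsMeasure (F.PP F.m (K + n)) ((F.scheme ℰ γ).β (K + n)) := rfl
    _ = ∫ V, g (fun l => F.avgObs ℰ (K + n) (C l) (fieldShift (sitesPerDir_refine_zero F n K) V))
          ∂T4GenFunBounds.gibbsMeasure (F.PP (F.m + n) K) ((F.scheme ℰ γ).β (K + n)) :=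
        (integral_gibbsMeasure_comp_fieldShift (sitesPerDir_refine_zero F n K) hβ _).symm
    _ = ∫ V, g (fun l => coarseObs F n ℰ [C l] (unitShift (F.refine n) K
          (Averaging.iter (fun j => BlockAveraging.blockAvg (P := F.PP (F.m + n) K) (j := j) ℰ) K V)))
          ∂T4GenFunBounds.gibbsMeasure (F.PP (F.m + n) K) ((F.scheme ℰ γ).β (K + n)) := by
        simp only [hcs, avgObs_refine]
    _ = ∫ u, g (fun l => coarseObs F n ℰ [C l] u) ∂(F.refine n).unitLaw ℰ hE (γ * ((F.L : ℝ)⁻¹) ^ n) K := by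
        rw [integral_unitLaw hE K hmeas, T3Family.refine_β]
        rfl

/-- No atom at `m` ⇒ windows around `m` of arbitrarily small mass (single-point continuity of a finite measure). [folklore] -/
private theorem exists_window_le {X : Type*} [MeasurableSpace X] (ν : Measure X) [IsFiniteMeasure ν] {W : X → ℝ} (hWm : Measurable W)
    (m : ℝ) (h0 : ν {u | W u = m} = 0) {ε : ℝ} (hε : 0 < ε) : ∃ δ : ℝ, 0 < δ ∧ ν.real {u | |W u - m| < δ} ≤ ε := by
  set s : ℕ → Set X := fun n => {u | |W u - m| < 1 / ((n : ℝ) + 1)} with hs_def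
  have hmeas : ∀ n, NullMeasurableSet (s n) ν := fun n =>
    (measurableSet_lt ((hWm.sub measurable_const).abs) measurable_const).nullMeasurableSet
  have hanti : Antitone s := by
    intro a b hab u hu
    simp only [hs_def, mem_setOf_eq] at hu ⊢
    have hab' : (a : ℝ) + 1 ≤ (b : ℝ) + 1 := by exact_mod_cast Nat.succ_le_succ hab
    exact hu.trans_le (one_div_le_one_div_of_le (by positivity) hab')
  have hI : (⋂ n, s n) = {u | W u = m} := by
    ext u
    simp only [mem_iInter, hs_def, mem_setOf_eq]
    constructor
    · intro hu
      by_contra hne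
      have hpos : 0 < |W u - m| := abs_pos.mpr (sub_ne_zero.mpr hne)
      obtain ⟨n, hn⟩ := exists_nat_one_div_lt hpos
      exact (lt_irrefl _) ((hu n).trans hn)
    · intro hu n
      rw [hu, sub_self, abs_zero]
      positivity
  have hlim := tendsto_measure_iInter_atTop hmeas hanti ⟨0, measure_ne_top _ _⟩
  rw [hI, h0] at hlim
  have hev : ∀ᶠ n in atTop, ν (s n) < ENNReal.ofReal ε := hlim.eventually (gt_mem_nhds (by simpa using hε))
  obtain ⟨n, hn⟩ := hev.exists
  exact ⟨1 / ((n : ℝ) + 1), by positivity, ENNReal.toReal_le_of_le_ofReal hε.le hn.le⟩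

/-- `max 0 (1 − |t − a|/δ) ≤ 𝟙{|t − a| < δ}` (`δ > 0`). [folklore] -/
private theorem tentFun_le_indicator {a δ : ℝ} (hδ : 0 < δ) (t : ℝ) :
    max 0 (1 - |t - a| / δ) ≤ Set.indicator {t : ℝ | |t - a| < δ} 1 t := by
  by_cases ht : |t - a| < δ
  · rw [Set.indicator_of_mem (show t ∈ {t : ℝ | |t - a| < δ} from ht), Pi.one_apply]
    exact max_le zero_le_one (by linarith [div_nonneg (abs_nonneg (t - a)) hδ.le])
  · rw [Set.indicator_of_notMem (show t ∉ {t : ℝ | |t - a| < δ} from ht)]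
    refine max_le le_rfl ?_
    have : 1 ≤ |t - a| / δ := by rw [le_div_iff₀ hδ, one_mul]; exact not_lt.mp ht
    linarith

/-- **THE CONTINUUM LOOP LAW CHARGES NO HYPERPLANE OF PRIVATE-BOND SIMPLE-LOOP COORDINATES** (from a refinement's tilt, `SU(2)`, printed
averaging, `γ ≥ 0`): under `UnitTiltTail (F.refine n) ℰp (γL^{-n}) r w w'` with summable rates, if `ν` is the weak limit of the loop laws of `(F, γ)`,
`C : Fin k → ULoop3 F`, the `i`-th label visits the bond of `s` exactly once, NO other `C l` visits it, and `a i ≠ 0`, then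
`ν{y | Σ_l a l · y_{C l} = t} = 0` for every `t` — no deterministic linear relation among these continuum loop variables (joint non-degeneracy:
every `aᵀ Σ a = Var_ν(Σ a_l x_{C l})` is then positive, the covariance matrix is non-singular). [cite: King1986, Thm 3.4 (3.13) p.657] -/
theorem limitLaw_apply_linCombLevel_eq_zero_of_refine_unitTiltTail (F : T3Family) (n : ℕ) {γ : ℝ} (hγ : 0 ≤ γ)
    (h : UnitTiltTail (F.refine n) ℰp (γ * ((F.L : ℝ)⁻¹) ^ n) r w w') (hr : Summable r) (hw : Summable w) (hw' : Summable w')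
    {ν : ProbabilityMeasure (Cube (ULoop3 F))} (hν : Tendsto (loopLaw F (F.avgMeasurable_of_measurableE ℰp measurableE_ℰp) hγ) atTop (𝓝 ν))
    (C : Fin k → ULoop3 F) (a : Fin k → ℝ) (i : Fin k) (γ₁ γ₂ : List (LStep (F.P 0) 0)) (s : LStep (F.P 0) 0)
    (hCi : (C i).1.atLevel 0 = γ₁ ++ s :: γ₂) (h₁ : ∀ s' ∈ γ₁, s'.bond ≠ s.bond) (h₂ : ∀ s' ∈ γ₂, s'.bond ≠ s.bond)
    (hpriv : ∀ l, l ≠ i → ∀ s' ∈ (C l).1.atLevel 0, s'.bond ≠ s.bond) (hai : a i ≠ 0) (t : ℝ) :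
    (ν : Measure (Cube (ULoop3 F))) {y | ∑ l, a l * ((y (C l) : Set.Icc (-1 : ℝ) 1) : ℝ) = t} = 0 := by
  have hγ' : 0 ≤ γ * ((F.L : ℝ)⁻¹) ^ n := mul_nonneg hγ (pow_nonneg (inv_nonneg.mpr (Nat.cast_nonneg _)) _)
  set μ : ℕ → Measure (GaugeField ((F.refine n).P 0) 0 (Matrix.specialUnitaryGroup (Fin 2) ℂ)) :=
    fun K => (F.refine n).unitLaw ℰp measurableE_ℰp (γ * ((F.L : ℝ)⁻¹) ^ n) K with hμ_def
  haveI hP : ∀ K, IsProbabilityMeasure (μ K) := fun K => isProbabilityMeasure_unitLaw measurableE_ℰp hγ' K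
  -- the linear combination upstairs and on the cube
  set V : GaugeField ((F.refine n).P 0) 0 (Matrix.specialUnitaryGroup (Fin 2) ℂ) → ℝ :=
    fun u => ∑ l, a l * coarseObs F n ℰp [C l] u with hV_def
  have hVm : Measurable V := Finset.measurable_sum _ fun l _ => (measurable_coarseObs F n ℰp measurableE_ℰp [C l]).const_mul (a l)
  set Λ : Cube (ULoop3 F) → ℝ := fun y => ∑ l, a l * ((y (C l) : Set.Icc (-1 : ℝ) 1) : ℝ) with hΛ_def
  have hΛc : Continuous Λ :=
    continuous_finsetSum _ fun l _ => (continuous_subtype_val.comp (continuous_apply (C l))).const_smul (a l) |>.congr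
      (fun y => by simp [smul_eq_mul])
  set T : ℕ → ℝ := fun K₀ => ∑' i, (8 * r (K₀ + i) + 4 * w (K₀ + i) + 2 * w' (K₀ + i)) with hT_def
  have hT : Tendsto T atTop (𝓝 0) :=
    (tendsto_sum_nat_add fun k => 8 * r k + 4 * w k + 2 * w' k).congr fun K₀ => tsum_congr fun i => by rw [add_comm i K₀]
  set Sδ : ℝ → Set (GaugeField ((F.refine n).P 0) 0 (Matrix.specialUnitaryGroup (Fin 2) ℂ)) := fun δ => {u | |V u - t| < δ}
    with hSδ_def
  have hSm : ∀ δ, MeasurableSet (Sδ δ) := fun δ => measurableSet_lt ((hVm.sub measurable_const).abs) measurable_const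
  set A : Set (Cube (ULoop3 F)) := {y | Λ y = t} with hA_def
  have hAm : MeasurableSet A := hΛc.measurable (measurableSet_singleton t)
  -- STEP 1: `ν(A) ≤ μ_{K₀}(S_δ) + T K₀`
  have hstep : ∀ (δ : ℝ), 0 < δ → ∀ K₀ : ℕ, (ν : Measure (Cube (ULoop3 F))).real A ≤ (μ K₀).real (Sδ δ) + T K₀ := by
    intro δ hδ K₀
    let tent : Cube (ULoop3 F) →ᵇ ℝ := BoundedContinuousFunction.mkOfCompact
      ⟨fun y => max 0 (1 - |Λ y - t| / δ), continuous_const.max (continuous_const.sub ((hΛc.sub continuous_const).abs.div_const δ))⟩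
    have tent_apply : ∀ y, tent y = max 0 (1 - |Λ y - t| / δ) := fun y => rfl
    have hint_ν : (ν : Measure (Cube (ULoop3 F))).real A ≤ ∫ y, tent y ∂(ν : Measure (Cube (ULoop3 F))) := by
      rw [← integral_indicator_one hAm]
      refine integral_mono ((integrable_const (1 : ℝ)).indicator hAm) (tent.integrable _) fun y => ?_
      by_cases hy : y ∈ A
      · rw [Set.indicator_of_mem hy, Pi.one_apply, tent_apply]
        have hya : Λ y - t = 0 := sub_eq_zero.mpr hy
        rw [hya, abs_zero, zero_div, sub_zero, max_eq_right zero_le_one]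
      · rw [Set.indicator_of_notMem hy]
        exact (by rw [tent_apply]; exact le_max_left _ _)
    have hlaw : ∀ K, ∫ y, tent y ∂(loopLaw F (F.avgMeasurable_of_measurableE ℰp measurableE_ℰp) hγ (K + n) :
        Measure (Cube (ULoop3 F))) ≤ (μ K).real (Sδ δ) := by
      intro K
      have h1 : ∀ K' o U, |(F.scheme ℰp γ).obs K' o U| ≤ 1 := fun K' o U => F.abs_avgObs_le_one ℰp K' o U
      have hrw : ∫ y, tent y ∂(loopLaw F (F.avgMeasurable_of_measurableE ℰp measurableE_ℰp) hγ (K + n) :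
          Measure (Cube (ULoop3 F))) = ∫ u, max 0 (1 - |V u - t| / δ) ∂μ K := by
        rw [loopLaw, toMeasure_law, integral_map (measurable_obsVec _ (fun K C =>
          F.measurable_avgObs (F.avgMeasurable_of_measurableE ℰp measurableE_ℰp) K C) (K + n)).aemeasurable
          tent.continuous.aestronglyMeasurable]
        simp only [tent_apply, hΛ_def, coe_obsVec_apply _ h1]
        exact integral_comp_avgObsVec_refine F n ℰp measurableE_ℰp hγ K C (g := fun x => max 0 (1 - |(∑ l, a l * x l) - t| / δ))
          ((continuous_const.max (continuous_const.sub (((continuous_finsetSum _ fun l _ =>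
            (continuous_apply l).const_smul (a l) |>.congr (fun x => by simp [smul_eq_mul])).sub continuous_const).abs.div_const δ))).measurable)
      rw [hrw, ← integral_indicator_one (hSm δ)]
      have hgm : Measurable fun u => max 0 (1 - |V u - t| / δ) :=
        measurable_const.max (measurable_const.sub (((hVm.sub measurable_const).abs).div_const δ))
      have hgi : Integrable (fun u => max 0 (1 - |V u - t| / δ)) (μ K) :=
        (integrable_const (1 : ℝ)).mono' hgm.aestronglyMeasurable (ae_of_all _ fun u => by
          rw [Real.norm_eq_abs, abs_of_nonneg (le_max_left _ _)]
          exact max_le zero_le_one (by linarith [div_nonneg (abs_nonneg (V u - t)) hδ.le]))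
      exact integral_mono hgi ((integrable_const (1 : ℝ)).indicator (hSm δ)) fun u => tentFun_le_indicator hδ (V u)
    have hking := measureReal_unitLaw_le_add_tail (F := F.refine n) measurableE_ℰp hγ' h hr hw hw' (hSm δ) K₀
    have hlim : Tendsto (fun K => ∫ y, tent y ∂(loopLaw F (F.avgMeasurable_of_measurableE ℰp measurableE_ℰp) hγ K :
        Measure (Cube (ULoop3 F)))) atTop (𝓝 (∫ y, tent y ∂(ν : Measure (Cube (ULoop3 F))))) :=
      (ProbabilityMeasure.tendsto_iff_forall_integral_tendsto.mp hν) tent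
    have hlim' := (tendsto_add_atTop_iff_nat n).mpr hlim
    have hev : ∀ᶠ K in atTop, ∫ y, tent y ∂(loopLaw F (F.avgMeasurable_of_measurableE ℰp measurableE_ℰp) hγ (K + n) :
        Measure (Cube (ULoop3 F))) ≤ (μ K₀).real (Sδ δ) + T K₀ :=
      eventually_atTop.2 ⟨K₀, fun K hK => (hlaw K).trans (hking K hK)⟩
    exact hint_ν.trans (le_of_tendsto hlim' hev)
  -- STEP 2: `δ → 0` at fixed `K₀`, then `K₀ → ∞`
  have hK₀ : ∀ K₀ : ℕ, (ν : Measure (Cube (ULoop3 F))).real A ≤ T K₀ := by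
    intro K₀
    have hat : (μ K₀) {u | V u = t} = 0 :=
      refine_unitLaw_linCombLevel_eq_zero F n hγ' K₀ C a i γ₁ γ₂ s hCi h₁ h₂ hpriv hai t
    refine le_of_forall_pos_le_add fun ε hε => ?_
    obtain ⟨δ, hδ, hwin⟩ := exists_window_le (μ K₀) hVm t hat hε
    have := hstep δ hδ K₀
    linarith
  have hle0 : (ν : Measure (Cube (ULoop3 F))).real A ≤ 0 := ge_of_tendsto' hT hK₀
  have hreal : (ν : Measure (Cube (ULoop3 F))).real A = 0 := le_antisymm hle0 measureReal_nonneg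
  exact (measureReal_eq_zero_iff (measure_ne_top _ _)).mp hreal

end Limit

end Literature.MathematicalPhysics.QuantumFieldTheory.Balaban1983to89.T3LimitLawNoLinearRelation

end
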